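import Summits.BirchSwinnertonDyer.BirchSwinnertonDyer.Theorems.GenusKolyvaginAtTwoPowDvdShaCardAtTwoRTLocalKernelOneBit
import Summits.BirchSwinnertonDyer.BirchSwinnertonDyer.Theorems.GenusKolyvaginAtTwoPowDvdShaCardAtTwoRTLocalKernelQuadratic
import HarnessLib

/-!
# Route `GenusKolyvaginAtTwo`, LINE 18 / LINE 19 (L_T `PowDvdShaCardAtTwoRT` stmt-BirchSwinnertonDyer-23242, L⁺_T
# stmt-23379), critic idea-crit-5 VERDICT #179 price (1), quantitative half — THE ONE-BIT BOUND
# `#W_{v,K} ≤ #E(ℚ_v)[2]` AT A QUADRATIC PLACE `w ∣ v ∤ 2` (Kramer 1981 Prop. 3, upper half)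

Seat `bsd-line-gk2-p3` g17 (cell `bsd-f1-sign2`), `--supports stmt-BirchSwinnertonDyer-23242` (helper; closes nothing).
THEOREMS ONLY (no definition, no named fact, no `sorry`); BSD is not proved by any of this.

WHAT.  For an elliptic curve `E/ℚ`, a number field `K` and finite places `w ∣ v` with `[K_w : ℚ_v] = 2` and `w ∤ 2`,
Matsuno's local kernel `W_{v,K} = ker(H¹(ℚ_v, E) → H¹(K_w, E))` (`Matsuno2009.localKernel`) is FINITE of order
`≤ #E(ℚ_v)[2]` (`natCard_localKernel_le_natCard_twoTorsion`).  At a ramified odd prime `p ∣ d_K` of good reduction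
`E(ℚ_p)[2] ≅ Ẽ(𝔽_p)[2]`, so this is the upper half `#H¹(G, E(K_𝔭)) ≤ 2^{i_p}`, `i_p = dim Ẽ(𝔽_p)[2]`, of Kramer 1981
Prop. 3 (the local norm index at a ramified odd good prime); with the predecessor files it gives the LINE 18/19
dictionary of the `d_K`-relaxation place by place: cost `0` bits at split places (`…LocalKernelSplit`), `0` bits where
`E(ℚ_v)[2] = 0` (`…LocalKernelQuadratic`, `…TwoTorsionQuadratic`: `a_p` odd), `≤ 1` bit at a transposition prime
(`#E(ℚ_p)[2] = 2`), `≤ 2` bits where `E[2] ⊆ E(ℚ_p)`; always killed by `2` (`…LocalKernelTwoTorsion`).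

HOW.  §1 `natCard_localRestrictionKer_le_of_finrank_eq_two` — field level: `F` of characteristic `0`, `W/F`, `L/F` of
degree `2`, and `E(L)` with a `k` such that `2^k E(L)` has no `2`-torsion, `2^k E(L) ⊆ 2^{k+1} E(L)` and `E(L)/2^k E(L)`
finite: `ker(H¹(F, E) → H¹(L, E))` is finite of order `≤ #E(F)[2]`.  The kernel is inflated from the crossed
homomorphisms vanishing on `Γ_L = galRange L` (open of index `2`, invariants `S ≅ E(L)`, as in
`localRestrictionKer_eq_bot_of_finrank_eq_two`); the abstract bound `natCard_range_inflClass_le_of_index_two_of_divisible`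
(sibling file `…LocalKernelOneBit`, with `T = 2^k S`) bounds them by `#{s ∈ S : σ s = s, 2s = 0}`, and such `s` are
`Γ_F`-fixed, i.e. come from `E(F)[2]` (Galois descent `fixedPoints_eq_range_map_holds`).  §2 the `ℚ_v`-level statement:
`k` is supplied by `exists_pow_nsmul_uniquely_two_divisible` from the finite-index torsion-free `U ≤ E(K_w)` with
`[U : 2U] = #(𝒪_w/2) = 1` (`exists_finiteIndex_torsionFree_adicCompletion`, Silverman VII.6.3 / Milne I.3.3), transported
to the model `(E_{ℚ_v})_{K_w}` (`pointsCongr`), and `E(ℚ_v)[2]` is finite (`finite_ker_nsmul_adicCompletion`).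

References: [Kramer1981] §2 Prop. 3, §3 (proof of Thm. 2); [Matsuno2009] §3 (W_{v,K}), Lemma 4.2 (the lower bound,
not used); [SerreGaloisCohomology1997] I.§2.4, I.§5.8, II.§1.1; [MilneADT2006] I Lemma 3.3; [SilvermanAEC2009] VII.6.3,
VIII.§1.
-/

set_option autoImplicit false
-- the Theorems namespace of this sub repeats the summit name by design (D-0017 nested layout)
set_option linter.dupNamespace false

noncomputable section

open scoped Classical

namespace Summit.BirchSwinnertonDyer.BirchSwinnertonDyer.Theorems.GenusExact.PlusDescent

open WeierstrassCurve Literature.NumberTheory.EllipticCurves Literature.NumberTheory.GaloisRepresentations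
  Literature.Barriers.BirchSwinnertonDyer IntermediateField

universe u

/-! ## §1 Quadratic extensions of a field of characteristic `0`: `#ker(H¹(F, E) → H¹(L, E)) ≤ #E(F)[2]` -/

section Quadratic

variable {F : Type u} [Field F] (W : WeierstrassCurve F) (L : Type u) [Field L] [Algebra F L]

/-- **`#ker(H¹(F, E) → H¹(L, E)) ≤ #E(F)[2]` for a quadratic extension `L/F` whose points group has a uniquely
`2`-divisible `2^k E(L)` of finite index** (`F` of characteristic `0`, `W/F` any Weierstrass curve; the hypothesis
holds for every non-archimedean local field `L` of residue characteristic `≠ 2`).  The kernel — `H¹(Gal(L/F), E(L))`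
— is finite of order at most `#E(F)[2]`.  Proof: it is inflated from the crossed homomorphisms vanishing on the
open index-two subgroup `Γ_L = galRange L` (`resKer_le_range_inflClass`, `galRange_eq_fixingSubgroup_fieldRange`),
whose invariants are `S = E(j(L)) ≅ E(L)`; `natCard_range_inflClass_le_of_index_two_of_divisible` with `T = 2^k S`
bounds these by `#{s ∈ S : σ s = s, 2 s = 0}`, and such `s` are fixed by all of `Γ_F = Γ_L ∪ Γ_L σ`, hence come
from `E(F)` (`fixedPoints_eq_range_map_holds`), injectively and inside `E(F)[2]`.  Kramer 1981 Prop. 3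
(`#H¹(G, E(L)) = 2^{i(L/F)}`, `i(L/F) ≤ dim E(F)[2]`); Serre I.§2.4.
[cite: Kramer1981, §2 Prop. 3 and §3 (proof of Thm. 2)] [cite: SerreGaloisCohomology1997, I.§2.4 and I.§5.8] -/
theorem natCard_localRestrictionKer_le_of_finrank_eq_two [CharZero F] [FiniteDimensional F L]
    (h2 : Module.finrank F L = 2) (k : ℕ)
    (hk2 : ∀ P : (W.baseChange L).toAffine.Point, 2 • (2 ^ k • P) = 0 → 2 ^ k • P = 0)
    (hkdiv : ∀ P : (W.baseChange L).toAffine.Point,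
      ∃ Q : (W.baseChange L).toAffine.Point, 2 ^ k • P = 2 • (2 ^ k • Q))
    (hfin : Finite ((W.baseChange L).toAffine.Point ⧸
      (nsmulAddMonoidHom (2 ^ k) : (W.baseChange L).toAffine.Point →+ _).range))
    (hF2 : Finite {P : (W.baseChange F).toAffine.Point // 2 • P = 0}) :
    Finite (W.localRestrictionKer L) ∧
      Nat.card (W.localRestrictionKer L) ≤ Nat.card {P : (W.baseChange F).toAffine.Point // 2 • P = 0} := by
  haveI : Algebra.IsAlgebraic F L := Algebra.IsAlgebraic.of_finite F L
  haveI : IsGalois F (AlgebraicClosure F) := {}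
  -- the copy `j : L → F̄`, its field range `F'`, the open index-two subgroup `N = Γ_L` and a coset generator `σ`
  set e : AlgebraicClosure F ≃ₐ[F] AlgebraicClosure L := algEquivOfEmb L (closureEmb (K := F) L) with he
  set j : L →ₐ[F] AlgebraicClosure F :=
    ((e.symm : AlgebraicClosure L →ₐ[F] AlgebraicClosure F).comp
      (IsScalarTower.toAlgHom F L (AlgebraicClosure L))) with hj
  set F' : IntermediateField F (AlgebraicClosure F) := j.fieldRange with hF'
  set N : Subgroup (Field.absoluteGaloisGroup F) := galRange (K := F) L with hNdef
  have hN : N = F'.fixingSubgroup := galRange_eq_fixingSubgroup_fieldRange L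
  let eL : L ≃ₐ[F] F' := AlgHom.equivFieldRange j
  haveI : FiniteDimensional F F' := LinearEquiv.finiteDimensional eL.toLinearEquiv
  have hNopen : IsOpen (N : Set (Field.absoluteGaloisGroup F)) := by
    rw [hN]; exact IntermediateField.fixingSubgroup_isOpen F'
  have hidx : N.index = 2 := by
    rw [hN]
    refine ((IntermediateField.finrank_eq_fixingSubgroup_index F').symm.trans ?_)
    rw [← eL.toLinearEquiv.finrank_eq, h2]
  haveI : N.Normal := Subgroup.normal_of_index_eq_two hidx
  obtain ⟨σ, hσ⟩ := Subgroup.index_eq_two_iff.mp hidx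
  -- the invariants `S = E(F') ≅ E(L)`
  set m : (W.baseChange F').toAffine.Point →+ geomPoints W :=
    WeierstrassCurve.Affine.Point.map (W' := W) (F'.val : F' →ₐ[F] AlgebraicClosure F) with hm
  have hminj : Function.Injective m := WeierstrassCurve.Affine.Point.map_injective _
  set S : AddSubgroup (geomPoints W) := m.range with hSdef
  have hS : ∀ P : geomPoints W, P ∈ S ↔ ∀ n ∈ N, n • P = P := by
    intro P
    rw [hN]
    refine ⟨?_, mem_range_map_val_of_forall_smul_eq W F' P⟩
    rintro ⟨Q, rfl⟩ τ hτ
    exact smul_eq_of_map_val_eq W F' Q _ rfl hτ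
  let m₁ : (W.baseChange L).toAffine.Point →+ (W.baseChange F').toAffine.Point :=
    WeierstrassCurve.Affine.Point.map (W' := W) (eL : L →ₐ[F] F')
  have hm₁ : Function.Bijective m₁ := by
    refine ⟨WeierstrassCurve.Affine.Point.map_injective _, fun Q ↦
      ⟨WeierstrassCurve.Affine.Point.map (W' := W) (eL.symm : F' →ₐ[F] L) Q, ?_⟩⟩
    change WeierstrassCurve.Affine.Point.map _ (WeierstrassCurve.Affine.Point.map _ Q) = Q
    rw [WeierstrassCurve.Affine.Point.map_map, AlgEquiv.comp_symm]
    cases Q <;> rfl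
  let eS : (W.baseChange L).toAffine.Point ≃+ S :=
    (AddEquiv.ofBijective m₁ hm₁).trans (AddMonoidHom.ofInjective hminj)
  have heS : ∀ P : (W.baseChange L).toAffine.Point, ((eS P : S) : geomPoints W) = m (m₁ P) := fun _ ↦ rfl
  -- `T = 2^k S`: `σ`-stable, uniquely `2`-divisible, of finite index in `S`
  set T : AddSubgroup (geomPoints W) := S.map (nsmulAddMonoidHom (2 ^ k) : geomPoints W →+ _) with hTdef
  have hTS : T ≤ S := by
    rintro _ ⟨s, hs, rfl⟩
    exact S.nsmul_mem hs _
  have hσT : ∀ t ∈ T, σ • t ∈ T := by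
    rintro _ ⟨s, hs, rfl⟩
    refine ⟨σ • s, smul_mem_of_invariants hS hs σ, ?_⟩
    rw [nsmulAddMonoidHom_apply, nsmulAddMonoidHom_apply, smul_comm σ (2 ^ k : ℕ) s]
  have hT2 : ∀ t ∈ T, 2 • t = 0 → t = 0 := by
    rintro _ ⟨s, hs, rfl⟩ h0
    obtain ⟨P, hP⟩ := eS.surjective ⟨s, hs⟩
    have hsP : s = ((eS P : S) : geomPoints W) := by rw [hP]
    rw [nsmulAddMonoidHom_apply, hsP, heS, ← map_nsmul, ← map_nsmul] at h0 ⊢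
    rw [← map_nsmul, ← map_nsmul] at h0
    have h0' : 2 • (2 ^ k • P) = 0 := hm₁.1 (hminj (by rw [h0, map_zero, map_zero]))
    rw [hk2 P h0', map_zero, map_zero]
  have hTdiv : ∀ t ∈ T, ∃ u ∈ T, t = 2 • u := by
    rintro _ ⟨s, hs, rfl⟩
    obtain ⟨P, hP⟩ := eS.surjective ⟨s, hs⟩
    have hsP : s = ((eS P : S) : geomPoints W) := by rw [hP]
    obtain ⟨Q, hQ⟩ := hkdiv P
    refine ⟨(2 ^ k : ℕ) • ((eS Q : S) : geomPoints W), ⟨_, (eS Q).2, rfl⟩, ?_⟩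
    rw [nsmulAddMonoidHom_apply, hsP, heS, heS, ← map_nsmul, ← map_nsmul, hQ, map_nsmul, map_nsmul, map_nsmul,
      map_nsmul]
  have hfinT : (T.addSubgroupOf S).FiniteIndex := by
    -- `S / (T ∩ S)` is the image of `E(L) / 2^k E(L)`
    set R : AddSubgroup (W.baseChange L).toAffine.Point :=
      (nsmulAddMonoidHom (2 ^ k) : (W.baseChange L).toAffine.Point →+ _).range with hRdef
    have hle : R ≤ (T.addSubgroupOf S).comap eS.toAddMonoidHom := by
      rintro _ ⟨P, rfl⟩
      refine AddSubgroup.mem_comap.mpr (AddSubgroup.mem_addSubgroupOf.mpr ⟨((eS P : S) : geomPoints W), (eS P).2, ?_⟩)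
      change (2 ^ k : ℕ) • ((eS P : S) : geomPoints W) = ((eS ((2 ^ k : ℕ) • P) : S) : geomPoints W)
      rw [heS, heS, map_nsmul, map_nsmul]
    haveI := hfin
    have hsurj : Function.Surjective (QuotientAddGroup.map R (T.addSubgroupOf S) eS.toAddMonoidHom hle) :=
      QuotientAddGroup.map_surjective_of_surjective _ _ _
        (QuotientAddGroup.mk_surjective.comp eS.surjective) hle
    haveI : Finite (S ⧸ T.addSubgroupOf S) := Finite.of_surjective _ hsurj
    exact AddSubgroup.finiteIndex_of_finite_quotient
  -- the abstract bound
  obtain ⟨hfinR, hle⟩ := natCard_range_inflClass_le_of_index_two_of_divisible hNopen hσ S hS T hTS hσT hT2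
    hTdiv hfinT
  have hker : W.localRestrictionKer L ≤ (inflClass (geomPoints W) N hNopen).range :=
    resKer_le_range_inflClass (resGal (K := F) L) (pointsMap W L) (pointsMap_smul W L)
      (pointsMapOfEmb_bijective L W _) N hNopen (by rw [hNdef]; exact le_rfl)
  haveI := hfinR
  refine ⟨Finite.of_injective _ (AddSubgroup.inclusion_injective hker), ?_⟩
  -- `{s ∈ S : σ s = s, 2 s = 0} ↪ E(F)[2]` by Galois descent
  have hfix : ∀ x : {P : geomPoints W // P ∈ S ∧ σ • P = P ∧ 2 • P = 0},
      ∃ P₀ : (W.baseChange F).toAffine.Point,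
        (Affine.Point.baseChange F (AlgebraicClosure F) P₀ : geomPoints W) = x.1 := by
    intro x
    have hx : x.1 ∈ MulAction.fixedPoints (Field.absoluteGaloisGroup F) (geomPoints W) := by
      intro g
      by_cases hg : g ∈ N
      · exact (hS x.1).mp x.2.1 g hg
      · obtain ⟨n, hn, rfl⟩ := exists_eq_mul_of_not_mem hσ hg
        rw [mul_smul, x.2.2.1, (hS x.1).mp x.2.1 n hn]
    rw [fixedPoints_eq_range_map_holds W] at hx
    obtain ⟨P₀, hP₀⟩ := hx
    exact ⟨P₀, hP₀⟩
  have hbinj : Function.Injective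
      (fun P₀ : (W.baseChange F).toAffine.Point ↦ (Affine.Point.baseChange F (AlgebraicClosure F) P₀ : geomPoints W)) :=
    Affine.Point.map_injective _
  haveI := hF2
  refine ((AddSubgroup.card_le_of_le hker).trans hle).trans
    (Nat.card_le_card_of_injective (fun x ↦ (⟨(hfix x).choose, ?_⟩ :
    {P : (W.baseChange F).toAffine.Point // 2 • P = 0})) ?_)
  · apply hbinj
    change (Affine.Point.baseChange F (AlgebraicClosure F) (2 • (hfix x).choose) : geomPoints W) =
      Affine.Point.baseChange F (AlgebraicClosure F) 0
    rw [map_nsmul, map_zero, (hfix x).choose_spec]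
    exact x.2.2.2
  · intro x y hxy
    have h := congrArg (fun P : {P : (W.baseChange F).toAffine.Point // 2 • P = 0} ↦
      (Affine.Point.baseChange F (AlgebraicClosure F) P.1 : geomPoints W)) hxy
    simp only [(hfix x).choose_spec, (hfix y).choose_spec] at h
    exact Subtype.ext h

end Quadratic

/-! ## §2 `#W_{v,K} ≤ #E(ℚ_v)[2]` at a quadratic place `w ∣ v ∤ 2` -/

section Local

open NumberField IsDedekindDomain

/-- **THE ONE-BIT BOUND `#W_{v,K} ≤ #E(ℚ_v)[2]`** (Kramer 1981 Prop. 3, upper half; Matsuno 2009 §3 / Lemma 4.2).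
For an elliptic curve `E/ℚ`, a number field `K`, a finite place `v` of `ℚ` and `w ∣ v` of `K` with `[K_w : ℚ_v] = 2`
and `w ∤ 2`: Matsuno's `W_{v,K} = ker(H¹(ℚ_v, E) → H¹(K_w, E))` (`Matsuno2009.localKernel`) is FINITE and
`#W_{v,K} ≤ #E(ℚ_v)[2]`.  At a ramified odd prime `p ∣ d_K` of good reduction, `#E(ℚ_p)[2] = #Ẽ(𝔽_p)[2] = 2^{i_p}`:
the `d_K`-relaxed local condition of the (+)-descent (LINE 18/19, critic #179 price (1)) exceeds the Selmer condition
at `p` by AT MOST `i_p` bits — `0` at `a_p` odd, `≤ 1` at a transposition prime, `≤ 2` when `E[2] ⊆ E(ℚ_p)`.  Proof: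
§1 for `F = ℚ_v`, `L = K_w`, the uniquely `2`-divisible `2^k E(K_w)` being supplied by Silverman VII.6.3 / Milne I.3.3
(`exists_finiteIndex_torsionFree_adicCompletion`: `[U : 2U] = #(𝒪_w / 2) = 1` since `w ∤ 2`) through
`exists_pow_nsmul_uniquely_two_divisible`, transported to the model `(E_{ℚ_v})_{K_w}` (`pointsCongr`); `E(ℚ_v)[2]` is
finite (`finite_ker_nsmul_adicCompletion`). [cite: Kramer1981, §2 Prop. 3] [cite: Matsuno2009, §3 (p. 451, W_{v,K}) and Lemma 4.2]
[cite: MilneADT2006, I Lemma 3.3] [cite: SilvermanAEC2009, Prop. VII.6.3] -/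
theorem natCard_localKernel_le_natCard_twoTorsion (E : WeierstrassCurve ℚ) [E.IsElliptic]
    (K : Type) [Field K] [NumberField K] (v : HeightOneSpectrum (𝓞 ℚ)) (w : HeightOneSpectrum (𝓞 K))
    [w.asIdeal.LiesOver v.asIdeal]
    (h2 : letI : Algebra (v.adicCompletion ℚ) (w.adicCompletion K) :=
        (Literature.NumberTheory.EllipticCurves.adicCompletionMap (K := ℚ) K v w).toAlgebra
      Module.finrank (v.adicCompletion ℚ) (w.adicCompletion K) = 2)
    (hw : ((2 : ℕ) : 𝓞 K) ∉ w.asIdeal) :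
    Finite (Matsuno2009.localKernel E K v w) ∧
      Nat.card (Matsuno2009.localKernel E K v w) ≤
        Nat.card {P : (E.baseChange (v.adicCompletion ℚ)).toAffine.Point // 2 • P = 0} := by
  -- pin the `ℚ`-algebra structure of `ℚ_v` to the one inside `Matsuno2009.localKernel`
  letI instQv : Algebra ℚ (v.adicCompletion ℚ) :=
    IsDedekindDomain.HeightOneSpectrum.instAlgebraAdicCompletion (𝓞 ℚ) ℚ v
  letI : Algebra (v.adicCompletion ℚ) (w.adicCompletion K) :=
    (Literature.NumberTheory.EllipticCurves.adicCompletionMap (K := ℚ) K v w).toAlgebra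
  haveI : IsScalarTower ℚ (v.adicCompletion ℚ) (w.adicCompletion K) := IsScalarTower.rat
  haveI : IsScalarTower ℚ K (w.adicCompletion K) := IsScalarTower.rat
  haveI : CharZero (v.adicCompletion ℚ) :=
    charZero_of_injective_algebraMap (algebraMap ℚ (v.adicCompletion ℚ)).injective
  haveI : FiniteDimensional (v.adicCompletion ℚ) (w.adicCompletion K) :=
    Module.finite_of_finrank_eq_succ h2
  haveI hEK : (E.baseChange K).IsElliptic := by rw [WeierstrassCurve.baseChange]; infer_instance
  -- the models `(E_K)_{K_w}` and `(E_{ℚ_v})_{K_w}` of `E(K_w)`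
  let c : ((E.baseChange K).baseChange (w.adicCompletion K)).toAffine.Point ≃+
      ((E.baseChange (v.adicCompletion ℚ)).baseChange (w.adicCompletion K)).toAffine.Point :=
    (pointsCongr E K (w.adicCompletion K)).symm.trans (pointsCongr E (v.adicCompletion ℚ) (w.adicCompletion K))
  -- Silverman VII.6.3 / Milne I.3.3: a finite-index torsion-free `U ≤ E(K_w)` with `[U : 2U] = #(𝒪_w/2) = 1`
  obtain ⟨U, hU, htf, hidx⟩ := Literature.NumberTheory.EllipticCurves.LocalPoints.transfer c.symm
    ((E.baseChange K).exists_finiteIndex_torsionFree_adicCompletion w)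
  haveI := hU
  have hunit : IsUnit ((2 : ℕ) : w.adicCompletionIntegers K) := by
    rw [LocalPoints.isUnit_iff_valuation_eq_one]
    have h := LocalPoints.valuation_natCast_eq_one w hw
    exact_mod_cast h
  have hq1 : Nat.card (w.adicCompletionIntegers K ⧸ Ideal.span {((2 : ℕ) : w.adicCompletionIntegers K)}) = 1 := by
    rw [Ideal.span_singleton_eq_top.mpr hunit]
    exact Nat.card_unique
  have hUdiv : ∀ u ∈ U, ∃ u' ∈ U, u = 2 • u' := by
    have h1 : (U.map (nsmulAddMonoidHom 2 : _ →+ _)).relIndex U = 1 := by rw [hidx 2 two_ne_zero, hq1]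
    intro u hu
    obtain ⟨u', hu', hu'u⟩ := AddSubgroup.relIndex_eq_one.mp h1 hu
    exact ⟨u', hu', hu'u.symm⟩
  obtain ⟨k, hk2, hkdiv, hfin⟩ :=
    exists_pow_nsmul_uniquely_two_divisible U (fun u hu h ↦ htf 2 two_ne_zero u hu h) hUdiv
  -- `E(ℚ_v)[2]` is finite, read in the model `(E_{ℚ_v})_{ℚ_v}`
  let c₀ : (E.baseChange (v.adicCompletion ℚ)).toAffine.Point ≃+
      ((E.baseChange (v.adicCompletion ℚ)).baseChange (v.adicCompletion ℚ)).toAffine.Point :=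
    pointsCongr E (v.adicCompletion ℚ) (v.adicCompletion ℚ)
  let e₀ : {P : (E.baseChange (v.adicCompletion ℚ)).toAffine.Point // 2 • P = 0} ≃
      {P : ((E.baseChange (v.adicCompletion ℚ)).baseChange (v.adicCompletion ℚ)).toAffine.Point // 2 • P = 0} :=
    c₀.toEquiv.subtypeEquiv fun P ↦ by
      change 2 • P = 0 ↔ 2 • c₀ P = 0
      rw [← map_nsmul, map_eq_zero_iff c₀ c₀.injective]
  haveI : Finite {P : (E.baseChange (v.adicCompletion ℚ)).toAffine.Point // 2 • P = 0} := by
    haveI := E.finite_ker_nsmul_adicCompletion v (n := 2) two_ne_zero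
    exact Finite.of_equiv (nsmulAddMonoidHom 2 : (E.baseChange (v.adicCompletion ℚ)).toAffine.Point →+ _).ker
      (Equiv.subtypeEquivRight fun P ↦ by rw [AddMonoidHom.mem_ker, nsmulAddMonoidHom_apply])
  haveI hF2 : Finite {P : ((E.baseChange (v.adicCompletion ℚ)).baseChange (v.adicCompletion ℚ)).toAffine.Point //
      2 • P = 0} := Finite.of_equiv _ e₀
  -- §1 in the model, then back to `Matsuno2009.localKernel`
  have h := natCard_localRestrictionKer_le_of_finrank_eq_two (E.baseChange (v.adicCompletion ℚ))
    (w.adicCompletion K) h2 k hk2 hkdiv hfin hF2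
  rw [← Nat.card_congr e₀] at h
  unfold Matsuno2009.localKernel
  exact h

end Local

end Summit.BirchSwinnertonDyer.BirchSwinnertonDyer.Theorems.GenusExact.PlusDescent

end
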